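import Mathlib
import HarnessLib
import Summits.HubbardSuperconductivity.HubbardSuperconductivity.Theorems.KLProgrammeKLRegimeEngineV8DefsG13
import Summits.HubbardSuperconductivity.HubbardSuperconductivity.Theorems.KLProgrammeKLRegimeSplitSlotsV17F

/-!
# Route `KLProgramme` — ENGINE item stmt-HubbardSuperconductivity-20437 `KLRegimeEngineV17F2`, stub (c) value lane, «(c)-OUT» ASSEMBLY AT THE TOKEN OF RECORD `klEngGeo13`
# (AMENDMENT 24, plan g23 (R243)(3)): the out-of-class (E2″-F)ₙ₊₁ bracket from its three steps (cell gate-hubbard-kl, seat hubbard-kl-k3c2-p2 g19; memo OUT-OF-CLASS-E2.md §8–§10)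

The chain of record («UNSMEAR-RESUMMED», (R240)/(R243)(3′)), all at the LOWER frame `Kₙ` except the first link:
`𝒞ₙ₊₁[Kₙ₊₁] − 𝒞ₙ[Kₙ] = (𝒞ₙ₊₁[Kₙ₊₁] − 𝒞ₙ₊₁[Kₙ])` [(ii)′ frame shift of the scale-(n+1) amplitude, `≤ frameShiftBar P Q U (n+1)`, (F)(i)]
`+ (𝒞ₙ₊₁[Kₙ] − A°ₙ[s_{n,n+1}])` [(i) same-shell flow at `K := Kₙ`: `outClass_sameFrame_le_bars_share` at `s = ¼` ⇒ `≤ gainBar G11 (n+1) + ½·eremBar G11 n + thermalBar G11 (n+1)`]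
`+ (A°ₙ[s_{n,n+1}] − 𝒞ₙ[Kₙ])` [(iii) `member_sub_plain_le_shellLog`: `≤ Tb + (Klam U)²(2¹⁷klTS + 2²⁷)(klRelGain n ρpp + 2⁻ⁿ)`, `Tb` = class #5's relative bar for the pair
`(s_{n,n+1} | 0)` at `Qm`, booked like ONE in-class step: `≤ gainBar G11 (n+1) + ½·eremBar G11 n + thermalBar G11 (n+1)`].
* `xsMass_succ_le_gainBar_klEngGeo13` — the index shift of the Neumann term into the token's pp addend at the STEP's index `n+1`
  (`klRelGain n ≤ 4·klRelGain (n+1)`, `2⁻ⁿ = 2·2⁻⁽ⁿ⁺¹⁾`; `4·(2¹⁷klTS + 2²⁷) ≤ klXSA`);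
* **`outClass_hout_le_bars_klEngGeo13`** — the four values `a = 𝒞ₙ₊₁[Kₙ₊₁](Qm,k,k′)`, `b = 𝒞ₙ₊₁[Kₙ]`, `c = A°ₙ[s_{n,n+1}]`, `d = 𝒞ₙ[Kₙ]` with the three step bounds, the bar
  booking of `Tb` and `E₁ + E₂ ≤ eremBar klEngGeo11 … n` give LITERALLY the out-of-class (E2″-F)ₙ₊₁ bracket at `G = klEngGeo13`:
  `‖a − d‖ ≤ gainBar klEngGeo13 P U (n+1) ρpp ρd ρx + eremBar klEngGeo13 P Q U β L n + thermalBar klEngGeo13 P U β (n+1) + D + frameShiftBar P Q U (n+1)` (any `D ≥ 0`, the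
  `legDressBarQ2` slot).
What remains BY NAME for `hout` under AMENDMENT 24: (E4) data + sizes at quarter shares (step (i)); class #5's relative clause for `(s_{n,n+1} | 0)` at out-of-class `Qm`
+ its bar's one-step booking (step (iii), k3c1-p1 asks (a)/(b)); (F)(i) at scale `n+1`; the `RH/RL` rows; a priori `m`, smallness `m·Σ|t| ≤ 1/3`.
Arithmetic only; nothing about the model is asserted; nothing asserts (E2″-F), (c), K3 or superconductivity.  0 kit · 0 lit.
-/

noncomputable section

namespace Summit.HubbardSuperconductivity.HubbardSuperconductivity.Theorems.EngineV8

set_option linter.dupNamespace false -- summit = problem name (single-conjunct summit), D-0017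

open Real Finset Literature.MathematicalPhysics.QuantumLattice Literature.Probability.LatticeModels
open Summit.HubbardSuperconductivity.HubbardSuperconductivity.Theorems.KLRegimeSplit
open Summit.HubbardSuperconductivity.HubbardSuperconductivity.Theorems.KLProgrammeLegKernels
open Summit.HubbardSuperconductivity.HubbardSuperconductivity.Theorems.DispersionFlow

/-! ## §1 The Neumann term at the step's index -/

/-- `klRelGain n ρ + 2⁻ⁿ ≤ 4·(klRelGain (n+1) ρ + 2⁻⁽ⁿ⁺¹⁾)` (`0 ≤ ρ`). -/
theorem klRelGain_add_floor_le_four_mul_succ (n : ℕ) {ρ : ℝ} (hρ : 0 ≤ ρ) :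
    klRelGain n ρ + ((2 : ℝ) ^ n)⁻¹ ≤ 4 * (klRelGain (n + 1) ρ + ((2 : ℝ) ^ (n + 1))⁻¹) := by
  have h1 : klRelGain n ρ ≤ 4 * klRelGain (n + 1) ρ := by
    have h := klRelGain_pred_le (n + 1) hρ
    rwa [Nat.add_sub_cancel] at h
  have h2 : ((2 : ℝ) ^ n)⁻¹ = 2 * ((2 : ℝ) ^ (n + 1))⁻¹ := by rw [pow_succ, mul_inv]; field_simp
  have h3 : 0 ≤ ((2 : ℝ) ^ (n + 1))⁻¹ := by positivity
  rw [h2]; linarith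

/-- **THE NEUMANN TERM OF (iii) IN THE TOKEN'S pp ADDEND AT THE STEP'S INDEX**: for `0 ≤ ρpp`,
`(Klam U)²·(2¹⁷klTS + 2²⁷)·(klRelGain n ρpp + 2⁻ⁿ) ≤ gainBar klEngGeo13 P U (n+1) ρpp ρd ρx − 2·gainBar klEngGeo11 P U (n+1) ρpp ρd ρx`. -/
theorem xsMass_succ_le_gainBar_klEngGeo13 (P : SplitConsts) (U : ℝ) (n : ℕ) {ρpp : ℝ} (hρ : 0 ≤ ρpp) (ρd ρx : ℝ) :
    (P.Klam * U) ^ 2 * ((2 ^ 17 * klTS + 2 ^ 27) * (klRelGain n ρpp + ((2 : ℝ) ^ n)⁻¹)) ≤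
      gainBar klEngGeo13 P U (n + 1) ρpp ρd ρx - 2 * gainBar klEngGeo11 P U (n + 1) ρpp ρd ρx := by
  rw [gainBar_klEngGeo13_eq, add_sub_cancel_left, max_eq_left hρ]
  have hK : 0 ≤ (P.Klam * U) ^ 2 := sq_nonneg _
  have hT := klTS_nonneg
  have hg1 := klRelGain_nonneg (n + 1) hρ
  have h4 := klRelGain_add_floor_le_four_mul_succ n hρ
  have hX : 4 * (2 ^ 17 * klTS + 2 ^ 27) ≤ klXSA := by rw [klXSA_eq, klTSA_eq]; nlinarith
  have hg0 : 0 ≤ klRelGain (n + 1) ρpp + ((2 : ℝ) ^ (n + 1))⁻¹ := by positivity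
  have step : (2 ^ 17 * klTS + 2 ^ 27) * (klRelGain n ρpp + ((2 : ℝ) ^ n)⁻¹) ≤ klXSA * (klRelGain (n + 1) ρpp + ((2 : ℝ) ^ (n + 1))⁻¹) := by
    have hA : 0 ≤ 2 ^ 17 * klTS + (2 : ℝ) ^ 27 := by positivity
    calc (2 ^ 17 * klTS + 2 ^ 27) * (klRelGain n ρpp + ((2 : ℝ) ^ n)⁻¹)
        ≤ (2 ^ 17 * klTS + 2 ^ 27) * (4 * (klRelGain (n + 1) ρpp + ((2 : ℝ) ^ (n + 1))⁻¹)) := mul_le_mul_of_nonneg_left h4 hA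
      _ = 4 * (2 ^ 17 * klTS + 2 ^ 27) * (klRelGain (n + 1) ρpp + ((2 : ℝ) ^ (n + 1))⁻¹) := by ring
      _ ≤ klXSA * (klRelGain (n + 1) ρpp + ((2 : ℝ) ^ (n + 1))⁻¹) := mul_le_mul_of_nonneg_right hX hg0
  exact mul_le_mul_of_nonneg_left step hK

/-! ## §2 The out-of-class (E2″-F)ₙ₊₁ bracket at `klEngGeo13` from its three steps -/

/-- **«(c)-OUT» ASSEMBLED AT THE TOKEN** (module docstring): `a = 𝒞ₙ₊₁[Kₙ₊₁]`, `b = 𝒞ₙ₊₁[Kₙ]`, `c = A°ₙ[s_{n,n+1}]`, `d = 𝒞ₙ[Kₙ]` at `(Qm, k, k′)`; frame shift, step (i)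
at erem share `E₁`, step (iii) = `Tb` + Neumann term, `Tb` booked at erem share `E₂`, `E₁ + E₂ ≤ eremBar klEngGeo11 … n`, any `D ≥ 0` ⇒ the bracket at `klEngGeo13`. -/
theorem outClass_hout_le_bars_klEngGeo13 {P : SplitConsts} {Q : EngConsts} {U β : ℝ} {L n : ℕ} {ρpp ρd ρx : ℝ} (hρ : 0 ≤ ρpp)
    {a b c d : ℂ} {E₁ E₂ Tb D : ℝ}
    (hshift : ‖a - b‖ ≤ frameShiftBar P Q U (n + 1))
    (h₁ : ‖b - c‖ ≤ gainBar klEngGeo11 P U (n + 1) ρpp ρd ρx + E₁ + thermalBar klEngGeo11 P U β (n + 1))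
    (h₃ : ‖c - d‖ ≤ Tb + (P.Klam * U) ^ 2 * ((2 ^ 17 * klTS + 2 ^ 27) * (klRelGain n ρpp + ((2 : ℝ) ^ n)⁻¹)))
    (hTb : Tb ≤ gainBar klEngGeo11 P U (n + 1) ρpp ρd ρx + E₂ + thermalBar klEngGeo11 P U β (n + 1))
    (hE : E₁ + E₂ ≤ eremBar klEngGeo11 P Q U β L n) (hD : 0 ≤ D) :
    ‖a - d‖ ≤ gainBar klEngGeo13 P U (n + 1) ρpp ρd ρx + eremBar klEngGeo13 P Q U β L n + thermalBar klEngGeo13 P U β (n + 1) + D +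
      frameShiftBar P Q U (n + 1) := by
  have htri : ‖a - d‖ ≤ ‖a - b‖ + ‖b - c‖ + ‖c - d‖ := by
    have h1 := norm_sub_le_norm_sub_add_norm_sub a b d
    have h2 := norm_sub_le_norm_sub_add_norm_sub b c d
    linarith
  have hx := xsMass_succ_le_gainBar_klEngGeo13 P U n hρ ρd ρx
  have hth := two_mul_thermalBar_klEngGeo11_le_klEngGeo13 P U β (n + 1)
  have herem : eremBar klEngGeo13 P Q U β L n = eremBar klEngGeo11 P Q U β L n := eremBar_klEngGeo13_eq P Q U β L n
  rw [herem]
  linarith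

/-- **The same, `Tb` already folded** (for a supplier who hands step (iii) directly as `‖c − d‖ ≤ gainBar G11 + E₂ + thermalBar G11 + Neumann term`). -/
theorem outClass_hout_le_bars_klEngGeo13' {P : SplitConsts} {Q : EngConsts} {U β : ℝ} {L n : ℕ} {ρpp ρd ρx : ℝ} (hρ : 0 ≤ ρpp)
    {a b c d : ℂ} {E₁ E₂ D : ℝ}
    (hshift : ‖a - b‖ ≤ frameShiftBar P Q U (n + 1))
    (h₁ : ‖b - c‖ ≤ gainBar klEngGeo11 P U (n + 1) ρpp ρd ρx + E₁ + thermalBar klEngGeo11 P U β (n + 1))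
    (h₃ : ‖c - d‖ ≤ gainBar klEngGeo11 P U (n + 1) ρpp ρd ρx + E₂ + thermalBar klEngGeo11 P U β (n + 1) +
      (P.Klam * U) ^ 2 * ((2 ^ 17 * klTS + 2 ^ 27) * (klRelGain n ρpp + ((2 : ℝ) ^ n)⁻¹)))
    (hE : E₁ + E₂ ≤ eremBar klEngGeo11 P Q U β L n) (hD : 0 ≤ D) :
    ‖a - d‖ ≤ gainBar klEngGeo13 P U (n + 1) ρpp ρd ρx + eremBar klEngGeo13 P Q U β L n + thermalBar klEngGeo13 P U β (n + 1) + D +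
      frameShiftBar P Q U (n + 1) :=
  outClass_hout_le_bars_klEngGeo13 (Tb := gainBar klEngGeo11 P U (n + 1) ρpp ρd ρx + E₂ + thermalBar klEngGeo11 P U β (n + 1))
    hρ hshift h₁ (by linarith) le_rfl hE hD

end Summit.HubbardSuperconductivity.HubbardSuperconductivity.Theorems.EngineV8

end
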